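import Mathlib.NumberTheory.Padics.PadicNumbers
import Mathlib.NumberTheory.Padics.PadicIntegers
import Mathlib.NumberTheory.Padics.RingHoms
import Mathlib.NumberTheory.Padics.Hensel
import HarnessLib

/-!
# The `3`-adic normal form `y² + a₁xy + a₃y = x³` of a curve with a rational `3`-torsion point, II:
# a NON-CUBE `a₃` yields a point whose `y` is a NON-cube (Hensel), and Rizzo's Table-II special
# condition on row `(≥2, 3, 3)` (Kodaira III) forces `a₃ ≢ ±1 (mod 9)`, i.e. `a₃` a non-cube
# (cell `b2b-bsdres`; seat `b2b-bsdres-x11b3-p7` GEN 13 as CROSS-CELL POOL HAND on o5-r1 GEN 12's ask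
#  'x11b3: T29.6' — the unit half of the EVIDENCE law T29.6 `O5.FlatKummerImageTypeIIIThree` of
#  `HOME/b2b-bsdres-o5-r1/gen12/O5RationalTorsionCostLaw.lean` (typing A-O5-27, cc-typer-5); TOOL, theorems only)

HONEST FRAMING (cell `b2b-bsdres`, run/shared/lean/b2b/bsd-rank1-residual/, verbatim in every file): the
goal of the cell is to DELETE the COMBINATION-SHAPED residual classes of the Birch–Swinnerton-Dyer formula
for ALL analytic-rank `≤ 1` elliptic curves over `ℚ` — "full BSD formula for every rank `≤ 1` curve in
class `C`" assembled STRICTLY from published theorems — so that the rank-`≤ 1` remainder becomes exactly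
the CONSTRUCTION-SHAPED classes, which are TYPED (missing-input `Prop`s), NOT attempted. This is not
"finishing BSD". Lane CLASS-CLOSURE / teams o5–o6 (O5 OPEN): research routes; census output is
EVIDENCE, never a Literature fact; nothing is booked; no mark of `RESIDUAL-MAP.md` moves. This file:
THEOREMS ONLY (no definition, no named fact, no `@[conjecture]` node, no `sorry`; net named-fact debt
`0`). It proves NOTHING about any elliptic curve, Kodaira symbol, conductor or Selmer group: pure
`3`-adic algebra about the one cubic equation `y² + a₁xy + a₃y = x³` over `ℚ₃`.

## What is proved (all `[folklore]` except the finite check, which is Rizzo's row `(≥2, 3, 3)`)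

* §1 **`exists_pow_three_eq_of_norm_sub_one_le`**: `1 + 9ℤ₃ ⊆ ℚ₃^{×3}` — `‖c − 1‖ ≤ 3⁻²` makes `c` a
  cube, by Mathlib's `hensels_lemma` on the well-conditioned `3t³ + 3t² + t − (c − 1)/9` (then
  `c = (1 + 3t)³`; the naive `t³ − c` fails Hensel's strict inequality exactly at `‖c − 1‖ = 3⁻²`);
  **`not_exists_pow_three_eq_of_sq_ne_one`**: a unit `A ∈ ℤ₃` whose residue in `ℤ/9` has square
  `≠ 1` (`A ≢ ±1 (9)`) is not a cube in `ℚ₃` (a unit cube is `±1 mod 9`: finite check in `(ℤ/9)^×`).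
* §2 **`exists_point_not_cube`** (END-3, the UNIT half): if `‖a₃‖ = 1`, `‖a₁‖ < 1` and `a₃` is not
  a cube, the normal form has an affine point over `ℚ₃` with `x ≠ 0` and `y` NOT a cube — the point
  `(3, 27Z)`, `27Z² + (a₃ + 3a₁)Z − 1 = 0` by Hensel at the simple root `a₃⁻¹`; then
  `27Z = 27/(a₃·u)` with `u ∈ 1 + 9ℤ₃` a cube, so `y ≡ a₃⁻¹` modulo cubes.  (Its `y` is flat by the
  sibling file's `ne_zero_and_three_dvd_valuation`; together: o5-r1's `KummerImageHasUnitAtThree`.)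
* §3 residues modulo `9` with `a₁ = 3β`, `A₃` a unit: `‖9β³ − 8A₃‖ = ‖−27β⁶ + 36β³A₃ − 8A₃²‖ = 1`
  (so `v₃ c₄ = 2 + v₃ β`, `v₃ c₆ = 3`: row `(≥2, 3, 3)`), `c₆/27 ≡ A₃²` and `c₄/9 ≡ βA₃ (mod 9)`,
  `v₃Δ = 3 ⟹ 3(b³ − t) ≠ 0` in `ℤ/9`; the finite check **`zmod9_sq_ne_one_of_specialCondition`**:
  Rizzo's special condition `c₆'² + 2 ≡ 3c_{4,2} (9)` of row `(≥2, 3, 3)` — `t⁴ + 2 ≡ 3bt` if `3 ∤ b`,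
  `t⁴ + 2 ≡ 0` if `3 ∣ b` — with `b³ ≢ t (3)` forces `t² ≠ 1`; assembled as
  **`not_exists_pow_three_eq_of_specialCondition`** (END-4): on that row `A₃` is NOT a cube.  (A cube
  unit `A₃ ≡ ±1 (9)` always lands in Kodaira II there; the converse fails: `Y² + 4Y = X³` is II.)
Matching these residues with the tree's `Rizzo.tableII` inputs `res9 c₄, res9 c₆, val3 c₄` of
`Literature/…/RootNumberTableThree.lean` is the consumer's step (integers ↦ `PadicInt.toZModPow 2`).

References: O. G. Rizzo, *Average root numbers for a nonconstant family of elliptic curves*, Compositio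
Math. 136 (2003), Table II row `(≥2, 3, 3)` [Rizzo2003]; K. Conrad / J.-P. Serre folklore on cubes in
`ℚ₃` (`ℤ₃^{×3} = ±1 + 9ℤ₃`); o5-r1 GEN 12, `T29-RATIONAL-TORSION-COST-LAW.md` §3 (T29.6, EVIDENCE).
-/

noncomputable section

open Padic Polynomial

namespace Summit.BirchSwinnertonDyer.Rank1Residual.O5.ThreeTorsionNormalForm

/-! ## §1 Cubes in `ℚ₃`: `1 + 9ℤ₃ ⊆ ℚ₃^{×3}`, and a unit with `a² ≢ 1 (mod 9)` is not a cube -/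

/-- **`1 + 9ℤ₃ ⊆ ℤ₃^{×3}`.** If `‖c − 1‖ ≤ 3⁻²` then `c` is a cube in `ℚ₃`: Hensel's lemma for
`3t³ + 3t² + t − d` (`d = (c − 1)/9`, simple root near `d`), then `c = (1 + 3t)³`.  (The naive
Hensel on `t³ − c` fails at `‖c − 1‖ = 3⁻²` exactly; this better-conditioned cubic does not.) [folklore] -/
theorem exists_pow_three_eq_of_norm_sub_one_le {c : ℚ_[3]} (hc : ‖c - 1‖ ≤ (3 : ℝ) ^ (-2 : ℤ)) :
    ∃ w : ℚ_[3], c = w ^ 3 := by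
  have h9 : ‖(9 : ℚ_[3])‖ = (3 : ℝ) ^ (-2 : ℤ) := by
    rw [show (9 : ℚ_[3]) = (3 : ℚ_[3]) ^ 2 by norm_num, norm_pow]
    have : ‖(3 : ℚ_[3])‖ = (3 : ℝ)⁻¹ := by exact_mod_cast (Padic.norm_p (p := 3))
    rw [this]
    norm_num
  have hd' : ‖(c - 1) / 9‖ ≤ 1 := by
    rw [norm_div, h9, div_le_one (by positivity)]
    exact hc
  set d : ℤ_[3] := ⟨(c - 1) / 9, hd'⟩ with hd
  let F : ℤ_[3][X] := C 3 * X ^ 3 + C 3 * X ^ 2 + X - C d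
  have hF : ∀ t : ℤ_[3], aeval t F = 3 * t ^ 3 + 3 * t ^ 2 + t - d := fun t => by simp [F]
  have hF' : ∀ t : ℤ_[3], aeval t (derivative F) = 1 + 3 * (3 * t ^ 2 + 2 * t) := fun t => by
    simp [F, derivative_mul]
    ring
  have h3 : ‖(3 : ℤ_[3])‖ = (3 : ℝ)⁻¹ := by exact_mod_cast (PadicInt.norm_p (p := 3))
  have hder : ‖aeval d (derivative F)‖ = 1 := by
    rw [hF']
    have hlt : ‖(3 : ℤ_[3]) * (3 * d ^ 2 + 2 * d)‖ < ‖(1 : ℤ_[3])‖ := by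
      rw [norm_mul, h3, norm_one]
      calc (3 : ℝ)⁻¹ * ‖3 * d ^ 2 + 2 * d‖ ≤ 3⁻¹ * 1 := by gcongr; exact PadicInt.norm_le_one _
        _ < 1 := by norm_num
    rw [PadicInt.norm_add_eq_max_of_ne (ne_of_gt hlt), max_eq_left hlt.le, norm_one]
  have hval : ‖aeval d F‖ < ‖aeval d (derivative F)‖ ^ 2 := by
    rw [hder, one_pow, hF, show 3 * d ^ 3 + 3 * d ^ 2 + d - d = 3 * (d ^ 3 + d ^ 2) by ring,
      norm_mul, h3]
    calc (3 : ℝ)⁻¹ * ‖d ^ 3 + d ^ 2‖ ≤ 3⁻¹ * 1 := by gcongr; exact PadicInt.norm_le_one _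
      _ < 1 := by norm_num
  obtain ⟨t, ht, -⟩ := hensels_lemma hval
  rw [hF] at ht
  refine ⟨1 + 3 * (t : ℚ_[3]), ?_⟩
  have ht' : ((3 * t ^ 3 + 3 * t ^ 2 + t - d : ℤ_[3]) : ℚ_[3]) = 0 := by rw [ht]; rfl
  have hdc : ((d : ℤ_[3]) : ℚ_[3]) = (c - 1) / 9 := rfl
  have h3c : ((3 : ℤ_[3]) : ℚ_[3]) = 3 := by exact_mod_cast PadicInt.coe_natCast (p := 3) 3
  push_cast at ht'
  rw [hdc, h3c] at ht'
  linear_combination (-9 : ℚ_[3]) * ht'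

/-- A finite check in `ℤ/9`: the square of the cube of a unit is `1`. [folklore] -/
theorem zmod9_cube_sq_eq_one : ∀ s t : ZMod 9, s * t = 1 → (s ^ 3) ^ 2 = 1 := by decide

/-- **Non-cubes by residue.** A `3`-adic unit `A` whose residue modulo `9` has square `≠ 1`
(i.e. `A ≢ ±1 (mod 9)`) is not a cube in `ℚ₃`. [folklore] -/
theorem not_exists_pow_three_eq_of_sq_ne_one {A : ℤ_[3]} (hA : ‖A‖ = 1)
    (h : (PadicInt.toZModPow 2 A) ^ 2 ≠ 1) : ¬ ∃ w : ℚ_[3], (A : ℚ_[3]) = w ^ 3 := by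
  rintro ⟨w, hw⟩
  have hw1 : ‖w‖ = 1 := by
    have h3 : ‖w‖ ^ 3 = 1 := by rw [← norm_pow, ← hw, ← PadicInt.norm_def, hA]
    have h0 : 0 ≤ ‖w‖ := norm_nonneg _
    nlinarith [sq_nonneg (‖w‖ - 1), sq_nonneg ‖w‖]
  set W : ℤ_[3] := ⟨w, hw1.le⟩ with hW
  have hAW : A = W ^ 3 := by
    apply Subtype.ext
    rw [PadicInt.coe_pow]
    exact hw
  have hWu : IsUnit W := PadicInt.isUnit_iff.mpr (by rw [PadicInt.norm_def]; exact hw1)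
  obtain ⟨V, hV⟩ := hWu.exists_right_inv
  apply h
  rw [hAW, map_pow]
  exact zmod9_cube_sq_eq_one _ _ (by rw [← map_mul, hV, map_one])

/-! ## §2 The UNIT half: a point whose tangent value is a flat NON-cube -/

/-- **END-3 (the unit half of T29.6 in normal form).** If `a₃` is a `3`-adic unit which is NOT a
cube in `ℚ₃` and `3 ∣ a₁` (`‖a₁‖ < 1`), then the normal form `y² + a₁xy + a₃y = x³` has an affine
point over `ℚ₃` with `x ≠ 0` whose `y` is NOT a cube (and flat, by the sibling file's END-2): the point
`(3, 27Z)` with `27Z² + (a₃ + 3a₁)Z − 1 = 0` (Hensel at the simple root `Z₀ = a₃⁻¹`), for which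
`y = 27Z = 27 / (a₃ · u)` with `u ∈ 1 + 9ℤ₃ ⊆ ℚ₃^{×3}`, so `y ≡ a₃⁻¹` modulo cubes. [folklore] -/
theorem exists_point_not_cube {a₁ a₃ : ℚ_[3]} (ha₃ : ‖a₃‖ = 1) (ha₁ : ‖a₁‖ < 1)
    (hnc : ¬ ∃ w : ℚ_[3], a₃ = w ^ 3) :
    ∃ x y : ℚ_[3], y ^ 2 + a₁ * x * y + a₃ * y = x ^ 3 ∧ x ≠ 0 ∧ ¬ ∃ w : ℚ_[3], y = w ^ 3 := by
  have ha₃0 : a₃ ≠ 0 := by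
    rintro rfl
    simp at ha₃
  -- norm constants
  have hn3 : ‖(3 : ℚ_[3])‖ = (3 : ℝ)⁻¹ := by exact_mod_cast (Padic.norm_p (p := 3))
  have hn27 : ‖(27 : ℚ_[3])‖ = ((3 : ℝ) ^ 3)⁻¹ := by
    rw [show (27 : ℚ_[3]) = (3 : ℚ_[3]) ^ 3 by norm_num, norm_pow, hn3, inv_pow]
  have hn3' : ‖(3 : ℤ_[3])‖ = (3 : ℝ)⁻¹ := by exact_mod_cast (PadicInt.norm_p (p := 3))
  have ha₁' : ‖a₁‖ ≤ (3 : ℝ)⁻¹ := by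
    have := (Padic.norm_lt_pow_iff_norm_le_pow_sub_one a₁ 0).mp (by simpa using ha₁)
    simpa using this
  -- integers
  set A₁ : ℤ_[3] := ⟨a₁, ha₁.le⟩ with hA₁
  set A₃ : ℤ_[3] := ⟨a₃, ha₃.le⟩ with hA₃
  have hA₃n : ‖A₃‖ = 1 := by rw [PadicInt.norm_def]; exact ha₃
  set Z₀ : ℤ_[3] := A₃.inv with hZ₀
  have hZ₀ : A₃ * Z₀ = 1 := PadicInt.mul_inv hA₃n
  -- the polynomial `G = 27 Z² + (A₃ + 3A₁) Z − 1`
  let G : ℤ_[3][X] := C 27 * X ^ 2 + C (A₃ + 3 * A₁) * X - 1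
  have hG : ∀ t : ℤ_[3], aeval t G = 27 * t ^ 2 + (A₃ + 3 * A₁) * t - 1 := fun t => by simp [G]
  have hG' : ∀ t : ℤ_[3], aeval t (derivative G) = A₃ + 3 * (18 * t + A₁) := fun t => by
    simp [G, derivative_mul]
    ring
  have hder : ‖aeval Z₀ (derivative G)‖ = 1 := by
    rw [hG']
    have hlt : ‖(3 : ℤ_[3]) * (18 * Z₀ + A₁)‖ < ‖A₃‖ := by
      rw [norm_mul, hn3', hA₃n]
      calc (3 : ℝ)⁻¹ * ‖18 * Z₀ + A₁‖ ≤ 3⁻¹ * 1 := by gcongr; exact PadicInt.norm_le_one _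
        _ < 1 := by norm_num
    rw [PadicInt.norm_add_eq_max_of_ne (ne_of_gt hlt), max_eq_left hlt.le, hA₃n]
  have hval : ‖aeval Z₀ G‖ < ‖aeval Z₀ (derivative G)‖ ^ 2 := by
    rw [hder, one_pow, hG, show 27 * Z₀ ^ 2 + (A₃ + 3 * A₁) * Z₀ - 1
        = 3 * (9 * Z₀ ^ 2 + A₁ * Z₀) + (A₃ * Z₀ - 1) by ring, hZ₀, sub_self, add_zero, norm_mul, hn3']
    calc (3 : ℝ)⁻¹ * ‖9 * Z₀ ^ 2 + A₁ * Z₀‖ ≤ 3⁻¹ * 1 := by gcongr; exact PadicInt.norm_le_one _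
      _ < 1 := by norm_num
  obtain ⟨Z, hZ, -⟩ := hensels_lemma hval
  rw [hG] at hZ
  -- transport the root to `ℚ₃`
  set z : ℚ_[3] := (Z : ℚ_[3]) with hz
  have hz1 : ‖z‖ ≤ 1 := Z.2
  have hZ' : ((27 * Z ^ 2 + (A₃ + 3 * A₁) * Z - 1 : ℤ_[3]) : ℚ_[3]) = 0 := by rw [hZ]; rfl
  have h3c : ((3 : ℤ_[3]) : ℚ_[3]) = 3 := by exact_mod_cast PadicInt.coe_natCast (p := 3) 3
  have h27c : ((27 : ℤ_[3]) : ℚ_[3]) = 27 := by exact_mod_cast PadicInt.coe_natCast (p := 3) 27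
  have hA₁c : ((A₁ : ℤ_[3]) : ℚ_[3]) = a₁ := rfl
  have hA₃c : ((A₃ : ℤ_[3]) : ℚ_[3]) = a₃ := rfl
  push_cast at hZ'
  rw [h3c, h27c, hA₁c, hA₃c, ← hz] at hZ'
  -- hZ' : 27 * z ^ 2 + (a₃ + 3 * a₁) * z - 1 = 0
  refine ⟨3, 27 * z, by linear_combination (27 : ℚ_[3]) * hZ', by norm_num, ?_⟩
  · -- `y = 27 z` is not a cube: `t z = 1` with `t = a₃ u`, `u ∈ 1 + 9ℤ₃` a cube
    set t : ℚ_[3] := a₃ + 3 * a₁ + 27 * z with ht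
    have htz : t * z = 1 := by rw [ht]; linear_combination hZ'
    have hz0 : z ≠ 0 := fun h0 => by rw [h0, mul_zero] at htz; exact zero_ne_one htz
    set u : ℚ_[3] := t * a₃⁻¹ with hu
    have hu1 : ‖u - 1‖ ≤ (3 : ℝ) ^ (-2 : ℤ) := by
      have : u - 1 = (3 * a₁ + 27 * z) * a₃⁻¹ := by rw [hu, ht]; field_simp; ring
      rw [this, norm_mul, norm_inv, ha₃, inv_one, mul_one]
      refine (Padic.nonarchimedean _ _).trans (max_le ?_ ?_)
      · rw [norm_mul, hn3]
        calc (3 : ℝ)⁻¹ * ‖a₁‖ ≤ 3⁻¹ * 3⁻¹ := by gcongr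
          _ = (3 : ℝ) ^ (-2 : ℤ) := by norm_num
      · rw [norm_mul, hn27]
        calc ((3 : ℝ) ^ 3)⁻¹ * ‖z‖ ≤ ((3 : ℝ) ^ 3)⁻¹ * 1 := by gcongr
          _ ≤ (3 : ℝ) ^ (-2 : ℤ) := by norm_num
    obtain ⟨w₀, hw₀⟩ := exists_pow_three_eq_of_norm_sub_one_le hu1
    have hu0 : u ≠ 0 := by
      rw [hu]
      exact mul_ne_zero (fun h0 => by rw [h0, zero_mul] at htz; exact zero_ne_one htz)
        (inv_ne_zero ha₃0)
    have hw₀0 : w₀ ≠ 0 := fun h0 => hu0 (by rw [hw₀, h0]; ring)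
    have hta : t = a₃ * w₀ ^ 3 := by
      rw [← hw₀, hu]; field_simp
    rintro ⟨w, hw⟩
    have hw0 : w ≠ 0 := by
      rintro rfl
      exact hz0 (by simpa using hw)
    apply hnc
    refine ⟨3 / (w₀ * w), ?_⟩
    -- from `t z = 1`, `t = a₃ w₀³`, `27 z = w³`
    have h27z : 27 * z = w ^ 3 := hw
    field_simp
    have : a₃ * w₀ ^ 3 * w ^ 3 = 27 := by
      calc a₃ * w₀ ^ 3 * w ^ 3 = t * (27 * z) := by rw [hta, h27z]
        _ = 27 * (t * z) := by ring
        _ = 27 := by rw [htz, mul_one]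
    linear_combination this

/-! ## §3 Residues modulo `9`: the Table II special condition forces a NON-cube `a₃`

With `a₁ = 3β` (`β ∈ ℤ₃`) and a unit `A₃`: `c₆ = 27 · (−27β⁶ + 36β³A₃ − 8A₃²)`, `c₄ = 9 · β(9β³ − 8A₃)`,
`Δ = 27 · A₃³(β³ − A₃)`; modulo `9` the bracketed quantities are `A₃²` and `βA₃`. -/

/-- `‖8‖₃ = 1`. [folklore] -/
theorem norm_eight : ‖(8 : ℤ_[3])‖ = 1 := by
  refine le_antisymm (PadicInt.norm_le_one _) (not_lt.mp fun h => ?_)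
  have := (PadicInt.norm_int_lt_one_iff_dvd (p := 3) 8).mp (by exact_mod_cast h)
  omega

/-- For a unit `A ∈ ℤ₃` and any `β`: `‖9β³ − 8A‖ = 1` and `‖−27β⁶ + 36β³A − 8A²‖ = 1` — so in
normal form `v₃(c₄) = 2 + v₃(β)` and `v₃(c₆) = 3` exactly (row `(≥ 2, 3, 3)` of Table II). [folklore] -/
theorem norm_c₄_c₆_brackets {β A : ℤ_[3]} (hA : ‖A‖ = 1) :
    ‖9 * β ^ 3 - 8 * A‖ = 1 ∧ ‖-27 * β ^ 6 + 36 * β ^ 3 * A - 8 * A ^ 2‖ = 1 := by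
  have hn3 : ‖(3 : ℤ_[3])‖ = (3 : ℝ)⁻¹ := by exact_mod_cast (PadicInt.norm_p (p := 3))
  have h8A : ‖-(8 * A)‖ = 1 := by rw [norm_neg, norm_mul, norm_eight, hA, one_mul]
  have h8A2 : ‖-(8 * A ^ 2)‖ = 1 := by rw [norm_neg, norm_mul, norm_pow, norm_eight, hA]; norm_num
  have small : ∀ x : ℤ_[3], ‖3 * x‖ < 1 := fun x => by
    rw [norm_mul, hn3]
    calc (3 : ℝ)⁻¹ * ‖x‖ ≤ 3⁻¹ * 1 := by gcongr; exact PadicInt.norm_le_one _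
      _ < 1 := by norm_num
  constructor
  · rw [show (9 : ℤ_[3]) * β ^ 3 - 8 * A = -(8 * A) + 3 * (3 * β ^ 3) by ring,
      PadicInt.norm_add_eq_max_of_ne (by rw [h8A]; exact (small _).ne'), h8A,
      max_eq_left (small _).le]
  · rw [show (-27 : ℤ_[3]) * β ^ 6 + 36 * β ^ 3 * A - 8 * A ^ 2
        = -(8 * A ^ 2) + 3 * (-9 * β ^ 6 + 12 * β ^ 3 * A) by ring,
      PadicInt.norm_add_eq_max_of_ne (by rw [h8A2]; exact (small _).ne'), h8A2,
      max_eq_left (small _).le]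

/-- Modulo `9`: `c₆ / 27 ≡ A₃²`. [folklore] -/
theorem toZModPow_two_c₆_bracket (β A : ℤ_[3]) :
    PadicInt.toZModPow 2 (-27 * β ^ 6 + 36 * β ^ 3 * A - 8 * A ^ 2) = (PadicInt.toZModPow 2 A) ^ 2 := by
  simp only [map_sub, map_add, map_mul, map_neg, map_pow, map_ofNat]
  generalize PadicInt.toZModPow 2 β = b
  generalize PadicInt.toZModPow 2 A = t
  revert b t
  decide

/-- Modulo `9`: `c₄ / 9 ≡ β A₃`. [folklore] -/
theorem toZModPow_two_c₄_bracket (β A : ℤ_[3]) :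
    PadicInt.toZModPow 2 (β * (9 * β ^ 3 - 8 * A)) = PadicInt.toZModPow 2 β * PadicInt.toZModPow 2 A := by
  simp only [map_sub, map_mul, map_pow, map_ofNat]
  generalize PadicInt.toZModPow 2 β = b
  generalize PadicInt.toZModPow 2 A = t
  revert b t
  decide

/-- In `ℤ/9`: `3x = 0` iff `x` dies in `ℤ/3`. [folklore] -/
theorem zmod9_three_mul_eq_zero_iff : ∀ x : ZMod 9,
    3 * x = 0 ↔ (ZMod.castHom (show 3 ∣ 9 by norm_num) (ZMod 3)) x = 0 := by decide

/-- `v₃(Δ) = 3` in residues: if `‖β³ − A‖ = 1` then `3 · (b³ − t) ≠ 0` in `ℤ/9`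
(`b, t` the residues of `β, A`). [folklore] -/
theorem three_mul_sub_ne_zero {β A : ℤ_[3]} (h : ‖β ^ 3 - A‖ = 1) :
    (3 : ZMod 9) * ((PadicInt.toZModPow 2 β) ^ 3 - PadicInt.toZModPow 2 A) ≠ 0 := by
  rw [← map_pow, ← map_sub, Ne, zmod9_three_mul_eq_zero_iff, ZMod.castHom_apply]
  set y := β ^ 3 - A
  have key : (ZMod.cast (PadicInt.toZModPow 2 y) : ZMod (3 ^ 1)) = PadicInt.toZModPow 1 y :=
    PadicInt.cast_toZModPow 1 2 (by norm_num) y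
  change ¬ (ZMod.cast (PadicInt.toZModPow 2 y) : ZMod (3 ^ 1)) = 0
  rw [key, ← RingHom.mem_ker, PadicInt.ker_toZModPow, ← PadicInt.norm_le_pow_iff_mem_span_pow, h]
  norm_num

/-- The decisive finite check in `ℤ/9` (Rizzo's Table II, row `(≥ 2, 3, 3)`): for a unit residue `t`
(of `a₃`) and any `b` (of `β = a₁/3`) with `b³ ≢ t (mod 3)` (`v₃Δ = 3`), the special condition
`c₆'² + 2 ≡ 3c_{4,2} (mod 9)` — which reads `t⁴ + 2 ≡ 3bt` if `3 ∤ b` and `t⁴ + 2 ≡ 0` if `3 ∣ b` —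
forces `t² ≠ 1`, i.e. `a₃ ≢ ±1 (mod 9)`. [cite: Rizzo2003, Table II (p. 4), row (≥2, 3, 3)] -/
theorem zmod9_sq_ne_one_of_specialCondition : ∀ t s b : ZMod 9, t * s = 1 →
    3 * (b ^ 3 - t) ≠ 0 → (3 * b = 0 → (t ^ 2) ^ 2 + 2 = 0) →
      (3 * b ≠ 0 → (t ^ 2) ^ 2 + 2 = 3 * b * t) → t ^ 2 ≠ 1 := by
  decide

/-- **END-4 (Table II ⟹ non-cube).** For a unit `A₃ ∈ ℤ₃` and `β ∈ ℤ₃` with `‖β³ − A₃‖ = 1`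
(`v₃Δ = 3` in normal form `a₁ = 3β`), if the residues `t, b` of `A₃, β` modulo `9` satisfy Table II's
special condition of row `(≥ 2, 3, 3)` (Kodaira III, `v(N) = 2`) in the form `3b = 0 → t⁴ + 2 = 0` and
`3b ≠ 0 → t⁴ + 2 = 3bt`, then `A₃` is NOT a cube in `ℚ₃`.  (A cube unit `A₃ ≡ ±1 (9)` always lands in
Kodaira II on that row.) [cite: Rizzo2003, Table II (p. 4), row (≥2, 3, 3)] -/
theorem not_exists_pow_three_eq_of_specialCondition {β A₃ : ℤ_[3]} (hA : ‖A₃‖ = 1)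
    (hΔ : ‖β ^ 3 - A₃‖ = 1)
    (hsp0 : 3 * PadicInt.toZModPow 2 β = 0 →
      ((PadicInt.toZModPow 2 A₃) ^ 2) ^ 2 + 2 = 0)
    (hsp1 : 3 * PadicInt.toZModPow 2 β ≠ 0 →
      ((PadicInt.toZModPow 2 A₃) ^ 2) ^ 2 + 2 = 3 * PadicInt.toZModPow 2 β * PadicInt.toZModPow 2 A₃) :
    ¬ ∃ w : ℚ_[3], (A₃ : ℚ_[3]) = w ^ 3 := by
  obtain ⟨S, hS⟩ := (PadicInt.isUnit_iff.mpr hA).exists_right_inv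
  refine not_exists_pow_three_eq_of_sq_ne_one hA
    (zmod9_sq_ne_one_of_specialCondition _ (PadicInt.toZModPow 2 S) _ ?_ (three_mul_sub_ne_zero hΔ)
      hsp0 hsp1)
  rw [← map_mul, hS, map_one]

end Summit.BirchSwinnertonDyer.Rank1Residual.O5.ThreeTorsionNormalForm

end
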